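import Mathlib.NumberTheory.NumberField.Units.DirichletTheorem
import Mathlib.NumberTheory.NumberField.InfinitePlace.Ramification
import Mathlib.LinearAlgebra.Trace
import HarnessLib

/-!
# The character of the unit representation: `tr(σ | E_K ⊗ ℚ) = #Fix(σ) - 1`

For a number field `K` and `σ ∈ Gal(K/ℚ)`, the automorphism `σ` acts on the finitely generated free
`ℤ`-module `E_K/μ_K = (𝓞 K)ˣ/torsion` (Dirichlet). **Its trace is the number of infinite places of `K`
fixed by `σ`, minus one** (`UnitGalois.trace_unitsModTorsion`): this is the classical fact
(Herbrand; Dirichlet's unit theorem in its Galois-module form) that `E_K ⊗ ℝ` is the permutation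
representation of `Gal` on the infinite places minus the trivial representation, which
[Schoof2009, Proposition 13.7] uses in the form "the logarithmic map is `ℤ[G⁺]`-linear, so
`(E⁺/{±1}) ⊗ ℝ ≅ ∏_φ ℝ`". We prove it from Mathlib's Dirichlet unit theorem: the logarithmic
embedding `logEmbedding : (𝓞 K)ˣ → ℝ^{w ≠ w₀}` has image a full lattice with `ℝ`-basis the images of
the fundamental system (`basisUnitLattice`, `Basis.ofZLatticeBasis`); the action of `σ` on units is
intertwined (`logMap_logEmbedding`) with the explicit `ℝ`-linear map
`logMap σ : v ↦ (w ↦ v_{σ⁻¹ w})` (with the dropped coordinate `v_{w₀} = -∑_{w ≠ w₀} v_w` restored where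
needed), so both have the same matrix in these bases (`toMatrix_logMap`) and the same trace, and the
trace of `logMap σ` in the standard basis counts fixed places (`trace_logMap`).

* `UnitGalois.unitsGal σ`, `UnitGalois.unitsModTorsion σ` — the action of `σ` on `(𝓞 K)ˣ` and the
  induced `ℤ`-linear map of `Additive ((𝓞 K)ˣ ⧸ torsion K)`;
* `UnitGalois.trace_unitsModTorsion` — **`tr_ℤ(σ | (𝓞 K)ˣ/torsion) = #{w | σ • w = w} - 1`**.

Everything is proved; the definitions are the maps `unitsGal`, `unitsModTorsion`, `logMap`.

## References

* R. Schoof, *Catalan's Conjecture*, Universitext, Springer 2009 [Schoof2009], Proposition 13.7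
  (proof) and Exercise 13.3 (book pp. 89–90) — held, `lit read book:schoof2009-catalan-s-conjecture`
  (PDF p. 168).
* L. C. Washington, *Introduction to Cyclotomic Fields*, GTM 83, Springer 1997 [Washington1997],
  §5.5 (units as Galois modules).
-/

namespace Literature.NumberTheory.NumberFields

namespace UnitGalois

open NumberField NumberField.InfinitePlace NumberField.Units NumberField.Units.dirichletUnitTheorem
open Module Finset
open scoped Classical

set_option backward.isDefEq.respectTransparency false
set_option maxSynthPendingDepth 3

variable {K : Type*} [Field K] [NumberField K]

/-! ### The Galois action on units and on units modulo torsion -/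

/-- `σ ∈ Gal(K/ℚ)` acting on the units of `𝓞 K`. [folklore] -/
noncomputable def unitsGal (σ : Gal(K/ℚ)) : (𝓞 K)ˣ →* (𝓞 K)ˣ :=
  Units.map (MulSemiringAction.toRingHom Gal(K/ℚ) (𝓞 K) σ)

/-- `σ(x)` in `K`. [folklore] -/
theorem coe_unitsGal (σ : Gal(K/ℚ)) (x : (𝓞 K)ˣ) :
    (((unitsGal σ x : (𝓞 K)ˣ) : 𝓞 K) : K) = σ ((x : 𝓞 K) : K) := rfl

/-- `unitsGal 1 = id`. [folklore] -/
theorem unitsGal_one (x : (𝓞 K)ˣ) : unitsGal (1 : Gal(K/ℚ)) x = x := by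
  ext; simp [unitsGal]

/-- `unitsGal (σ τ) = unitsGal σ ∘ unitsGal τ`. [folklore] -/
theorem unitsGal_mul (σ τ : Gal(K/ℚ)) (x : (𝓞 K)ˣ) :
    unitsGal (σ * τ) x = unitsGal σ (unitsGal τ x) := by
  ext; simp [unitsGal, mul_smul]

/-- `w(σ x) = (σ⁻¹ • w)(x)` for an infinite place `w`. [folklore] -/
theorem apply_unitsGal (σ : Gal(K/ℚ)) (w : InfinitePlace K) (x : (𝓞 K)ˣ) :
    w (((unitsGal σ x : (𝓞 K)ˣ) : 𝓞 K) : K) = (σ⁻¹ • w) ((x : 𝓞 K) : K) := by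
  rw [InfinitePlace.smul_apply, coe_unitsGal]
  rfl

/-- the torsion is Galois-stable. [folklore] -/
theorem unitsGal_mem_torsion (σ : Gal(K/ℚ)) {x : (𝓞 K)ˣ} (hx : x ∈ torsion K) :
    unitsGal σ x ∈ torsion K := by
  rw [mem_torsion] at hx ⊢
  intro w
  rw [apply_unitsGal]
  exact hx _

/-- `σ` on `(𝓞 K)ˣ ⧸ torsion`. [folklore] -/
noncomputable def modTorsionGal (σ : Gal(K/ℚ)) : (𝓞 K)ˣ ⧸ torsion K →* (𝓞 K)ˣ ⧸ torsion K :=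
  QuotientGroup.map (torsion K) (torsion K) (unitsGal σ) fun _ hx => unitsGal_mem_torsion σ hx

/-- **`σ` on the free `ℤ`-module `Additive ((𝓞 K)ˣ ⧸ torsion K)`**. [folklore] -/
noncomputable def unitsModTorsion (σ : Gal(K/ℚ)) :
    Additive ((𝓞 K)ˣ ⧸ torsion K) →ₗ[ℤ] Additive ((𝓞 K)ˣ ⧸ torsion K) :=
  (MonoidHom.toAdditive (modTorsionGal σ)).toIntLinearMap

/-- `unitsModTorsion σ [x] = [σ x]`. [folklore] -/
theorem unitsModTorsion_apply (σ : Gal(K/ℚ)) (x : (𝓞 K)ˣ) :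
    unitsModTorsion σ (Additive.ofMul (QuotientGroup.mk x)) =
      Additive.ofMul (QuotientGroup.mk (unitsGal σ x)) := rfl

/-! ### The intertwining linear map on the logarithmic space -/

/-- `mult` is Galois-invariant. [folklore] -/
theorem mult_smul (σ : Gal(K/ℚ)) (w : InfinitePlace K) : mult (σ • w) = mult w := by
  unfold mult
  by_cases h : IsReal w
  · rw [if_pos h, if_pos (isReal_smul_iff.mpr h)]
  · rw [if_neg h, if_neg (mt isReal_smul_iff.mp h)]

/-- **The linear map `logMap σ` of `ℝ^{w ≠ w₀}`**: `(logMap σ v)_w = v_{σ⁻¹ w}`, where the missing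
coordinate `v_{w₀}` is read as `-∑_{w ≠ w₀} v_w` (the sum-zero hyperplane of units).
[cite: Schoof2009, Proposition 13.7 (proof: "the logarithmic map is `ℤ[G⁺]`-linear")] -/
noncomputable def logMap (σ : Gal(K/ℚ)) : logSpace K →ₗ[ℝ] logSpace K where
  toFun v w := if h : σ⁻¹ • w.1 = w₀ then -∑ w', v w' else v ⟨σ⁻¹ • w.1, h⟩
  map_add' v v' := by
    funext w
    simp only [Pi.add_apply]
    split_ifs
    · rw [Finset.sum_add_distrib, neg_add]
    · rfl
  map_smul' c v := by
    funext w
    simp only [Pi.smul_apply, smul_eq_mul, RingHom.id_apply]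
    split_ifs
    · rw [mul_neg, Finset.mul_sum]
    · rfl

/-- the defining formula. [folklore] -/
theorem logMap_apply (σ : Gal(K/ℚ)) (v : logSpace K) (w : {w : InfinitePlace K // w ≠ w₀}) :
    logMap σ v w = if h : σ⁻¹ • w.1 = w₀ then -∑ w', v w' else v ⟨σ⁻¹ • w.1, h⟩ := rfl

/-- **`logMap σ` intertwines the Galois action on units**: `logMap σ (log x) = log (σ x)`.
[cite: Schoof2009, Proposition 13.7 (proof)] -/
theorem logMap_logEmbedding (σ : Gal(K/ℚ)) (x : (𝓞 K)ˣ) :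
    logMap σ (logEmbedding K (Additive.ofMul x)) = logEmbedding K (Additive.ofMul (unitsGal σ x)) := by
  funext w
  rw [logMap_apply, logEmbedding_component, apply_unitsGal, ← mult_smul σ⁻¹ w.1]
  split_ifs with h
  · rw [sum_logEmbedding_component, neg_mul, neg_neg, h]
  · rw [logEmbedding_component]

/-! ### The two matrices agree -/

/-- the `ℝ`-basis `log f_i` of the logarithmic space. [folklore] -/
noncomputable def logBasis (K : Type*) [Field K] [NumberField K] : Basis (Fin (rank K)) ℝ (logSpace K) :=
  (basisUnitLattice K).ofZLatticeBasis ℝ (unitLattice K)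

/-- `logBasis i = log (fundSystem i)`. [folklore] -/
theorem logBasis_apply (i : Fin (rank K)) :
    logBasis K i = logEmbedding K (Additive.ofMul (fundSystem K i)) := by
  rw [logBasis, Basis.ofZLatticeBasis_apply, logEmbedding_fundSystem]

/-- the logarithm of a unit in terms of the basis: `log y = ∑_i (b.repr [y])_i · log f_i`.
[folklore] -/
theorem logEmbedding_eq_sum (y : (𝓞 K)ˣ) :
    logEmbedding K (Additive.ofMul y) =
      ∑ i, (((basisModTorsion K).repr (Additive.ofMul (QuotientGroup.mk y)) i : ℤ) : ℝ) • logBasis K i := by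
  have h := (basisModTorsion K).sum_repr (Additive.ofMul (QuotientGroup.mk y))
  have h2 := congrArg (fun m => ((logEmbeddingEquiv K m : unitLattice K) : logSpace K)) h
  simp only [map_sum, map_zsmul, logEmbeddingEquiv_apply] at h2
  rw [← h2, Submodule.coe_sum]
  refine Finset.sum_congr rfl fun i _ => ?_
  rw [Submodule.coe_smul_of_tower, Int.cast_smul_eq_zsmul, logBasis, Basis.ofZLatticeBasis_apply,
    basisUnitLattice, Basis.map_apply]

/-- **the matrix of `logMap σ` in the basis `log f_i` is the integer matrix of `σ` on units modulo
torsion in the basis `f_i`.** [cite: Schoof2009, Proposition 13.7 (proof)] -/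
theorem toMatrix_logMap (σ : Gal(K/ℚ)) (i j : Fin (rank K)) :
    LinearMap.toMatrix (logBasis K) (logBasis K) (logMap σ) i j =
      ((LinearMap.toMatrix (basisModTorsion K) (basisModTorsion K) (unitsModTorsion σ) i j : ℤ) : ℝ) := by
  rw [LinearMap.toMatrix_apply, LinearMap.toMatrix_apply, logBasis_apply, logMap_logEmbedding,
    logEmbedding_eq_sum, (logBasis K).repr_sum_self, ← fundSystem_mk, unitsModTorsion_apply]

/-- hence the traces agree. [folklore] -/
theorem trace_unitsModTorsion_eq_trace_logMap (σ : Gal(K/ℚ)) :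
    ((LinearMap.trace ℤ _ (unitsModTorsion σ) : ℤ) : ℝ) = LinearMap.trace ℝ _ (logMap (K := K) σ) := by
  rw [LinearMap.trace_eq_matrix_trace ℤ (basisModTorsion K), LinearMap.trace_eq_matrix_trace ℝ (logBasis K),
    Matrix.trace, Matrix.trace]
  push_cast
  exact Finset.sum_congr rfl fun i _ => (toMatrix_logMap σ i i).symm

/-! ### The trace of `logMap σ` counts fixed places -/

/-- the trace of `logMap σ` in the standard basis. [folklore] -/
theorem trace_logMap (σ : Gal(K/ℚ)) :
    LinearMap.trace ℝ _ (logMap (K := K) σ) =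
      (Fintype.card {w : InfinitePlace K // σ • w = w} : ℝ) - 1 := by
  classical
  rw [LinearMap.trace_eq_matrix_trace ℝ (Pi.basisFun ℝ _), LinearMap.toMatrix_eq_toMatrix', Matrix.trace]
  simp only [Matrix.diag, LinearMap.toMatrix'_apply, logMap_apply]
  -- the diagonal entries as a function `D` of all places, vanishing at `w₀`
  set D : InfinitePlace K → ℝ :=
    fun w => (if σ⁻¹ • w = w then 1 else 0) - (if σ⁻¹ • w = w₀ then 1 else 0) with hD
  have hdiag : ∀ w : {w : InfinitePlace K // w ≠ w₀},
      (if h : σ⁻¹ • w.1 = w₀ then -∑ w' : {w : InfinitePlace K // w ≠ w₀}, (Pi.single w (1 : ℝ) : _ → ℝ) w'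
        else (Pi.single w (1 : ℝ) : _ → ℝ) ⟨σ⁻¹ • w.1, h⟩) = D w.1 := by
    intro w
    by_cases h1 : σ⁻¹ • w.1 = w₀
    · rw [dif_pos h1, Finset.sum_pi_single', if_pos (Finset.mem_univ _)]
      simp only [hD]
      have hne : σ⁻¹ • w.1 ≠ w.1 := fun h' => w.2 (by rw [← h', h1])
      rw [if_neg hne, if_pos h1]
      ring
    · rw [dif_neg h1, Pi.single_apply]
      simp only [hD]
      rw [if_neg h1, sub_zero]
      by_cases h2 : σ⁻¹ • w.1 = w.1
      · rw [if_pos (Subtype.ext h2), if_pos h2]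
      · rw [if_neg (fun h' => h2 (congrArg Subtype.val h')), if_neg h2]
  rw [Finset.sum_congr rfl (fun w _ => hdiag w)]
  have hD0 : D w₀ = 0 := by simp [hD]
  have hsum : ∑ w : {w : InfinitePlace K // w ≠ w₀}, D w.1 = ∑ w : InfinitePlace K, D w := by
    rw [Fintype.sum_eq_add_sum_subtype_ne _ w₀, hD0, zero_add]
  rw [hsum, hD, Finset.sum_sub_distrib, Finset.sum_boole, Finset.sum_boole]
  congr 1
  · -- `{w | σ⁻¹ w = w} = {w | σ w = w}`
    rw [Fintype.card_subtype]
    congr 2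
    ext w
    simp only [Finset.mem_filter, Finset.mem_univ, true_and]
    rw [inv_smul_eq_iff, eq_comm]
  · -- exactly one `w` with `σ⁻¹ w = w₀`
    rw [show (Finset.univ.filter fun w : InfinitePlace K => σ⁻¹ • w = w₀) = {σ • w₀} by
      ext w
      simp only [Finset.mem_filter, Finset.mem_univ, true_and, Finset.mem_singleton]
      rw [inv_smul_eq_iff]]
    simp

/-- **The character of the unit representation** (Herbrand; Dirichlet's unit theorem as a Galois
module): for `σ ∈ Gal(K/ℚ)` the trace of `σ` on the free `ℤ`-module `(𝓞 K)ˣ/torsion` equals the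
number of infinite places fixed by `σ` minus one.
[cite: Schoof2009, Proposition 13.7 (proof), Exercise 13.3] -/
theorem trace_unitsModTorsion (σ : Gal(K/ℚ)) :
    LinearMap.trace ℤ _ (unitsModTorsion (K := K) σ) =
      (Fintype.card {w : InfinitePlace K // σ • w = w} : ℤ) - 1 := by
  have h := trace_unitsModTorsion_eq_trace_logMap (K := K) σ
  rw [trace_logMap] at h
  exact_mod_cast h

end UnitGalois

end Literature.NumberTheory.NumberFields
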